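import Literature.NumberTheory.GaloisRepresentations.HasseArfLayerTrace
import HarnessLib

/-!
# Hasse–Arf, layer step II: the norm on the unit filtration of a cyclic layer of prime degree (Serre V §3, Lemma 5, Props. 4–5)

Continuation of `HasseArfLayerTrace.lean` (same global setting and notation: `R` Dedekind,
`K = Frac R`, `L/K` finite Galois with group `G`, `S = integralClosure R L`, `𝔓 ≠ 0` maximal with
separable residue extension, `F` an intermediate field with `Γ = Gal(L/F) ≤ T_𝔓`; here moreover
`|Γ| = ℓ` is prime and `t` is the jump of `Γ`: `Γ ≤ G_t`, `Γ ∩ G_{t+1} = 1`).  With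
`ψ(j) = j` for `j ≤ t` and `ψ(j) = t + ℓ (j - t)` for `j ≥ t` (written `min j t + ℓ (j - t)`),
`N = N_Γ`, `Tr = Tr_Γ`, and "`z ∈ U_F^j`" for `Γ`-invariant `z` written `z - 1 ∈ 𝔓 ^ (ℓ j)`:

* `exists_sum_eq_sum_smul_of_free` — orbit decomposition of a sum over a free `Γ`-set of
  subsets of `Γ`; `norm_one_add_eq` — **Serre V §3 Lemma 5**:
  `N(1 + y) = 1 + Tr(y) + N(y) + Tr(w)` with `w ∈ 𝔓 ^ (2m)` for `y ∈ 𝔓 ^ m`.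
* `norm_one_add_sub_one_mem_pow`, `norm_one_add_sub_one_mem_pow_succ` — **Prop. 4**:
  `N(U^{ψ(j)}) ⊆ U_F^j`, `N(U^{ψ(j)+1}) ⊆ U_F^{j+1}`.
* `mem_pow_succ_of_norm_one_add_sub_one_mem` — **Prop. 5 ii), iv) (injectivity off the jump)**:
  for `j ≠ t`, `y ∈ 𝔓^{ψ(j)}` and `N(1+y) ∈ U_F^{j+1}` force `y ∈ 𝔓^{ψ(j)+1}`.
* `exists_norm_one_add_sub_mem_pow` — **Prop. 5 iv) (surjectivity above the jump)**: for `j > t`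
  every `z ∈ U_F^j` is `≡ N(1 + y)` modulo `U_F^{j+1}` for some `y ∈ 𝔓^{ψ(j)}`.

Only these consequences of Serre's Props. 4–5 are needed for the Hasse–Arf theorem (Ch. V §7);
the exact kernel of `N_t` (Prop. 5 iii), the Artin–Schreier polynomial) is not formalised.

## References

* J.-P. Serre, *Local Fields*, GTM 67, Springer 1979: Ch. V §3, Lemma 5, Prop. 4, Prop. 5 and
  Cor. 1–3 (pp. 83–85). [SerreLocalFields1979]
-/

open Polynomial
open scoped Pointwise

noncomputable section

namespace Literature.NumberTheory.GaloisRepresentations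

/-! ### Sums over free `Γ`-sets of subsets: orbit decomposition -/

section Orbits

variable {Γ : Type*} [Group Γ] [Fintype Γ] [DecidableEq Γ]
  {A : Type*} [AddCommMonoid A] [DistribMulAction Γ A]

/-- **Orbit decomposition.**  Let the finite group `Γ` act on its subsets by left translation
(`T ↦ g T`), let `X` be a translation-stable finite set of subsets on which the action is free, and
let `f` be an equivariant function into a `Γ`-module (`f(gT) = g f(T)`) with values in an additive
submonoid `P`.  Then `Σ_{T ∈ X} f(T) = Σ_{g ∈ Γ} g w` for some `w ∈ P` (the sum of `f` over a set
of orbit representatives).  Used for Serre's Lemma V.3.5. [folklore] -/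
theorem exists_sum_eq_sum_smul_of_free (P : AddSubmonoid A) (f : Finset Γ → A)
    (hf : ∀ (g : Γ) (T : Finset Γ), f (T.image (g * ·)) = g • f T) (X : Finset (Finset Γ))
    (hX : ∀ (g : Γ), ∀ T ∈ X, T.image (g * ·) ∈ X)
    (hfree : ∀ (g : Γ), g ≠ 1 → ∀ T ∈ X, T.image (g * ·) ≠ T)
    (hP : ∀ T ∈ X, f T ∈ P) :
    ∃ w ∈ P, ∑ T ∈ X, f T = ∑ g : Γ, g • w := by
  -- translation of subsets is an action
  have htr_mul : ∀ (g h : Γ) (T : Finset Γ),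
      (T.image (h * ·)).image (g * ·) = T.image ((g * h) * ·) := fun g h T => by
    rw [Finset.image_image]
    exact Finset.image_congr fun x _ => (mul_assoc g h x).symm
  have htr_one : ∀ T : Finset Γ, T.image ((1 : Γ) * ·) = T := fun T => by
    simp only [one_mul, Finset.image_id']
  -- strong induction on `X`
  induction X using Finset.strongInduction with
  | H X ih =>
    by_cases hXe : X = ∅
    · subst hXe
      exact ⟨0, P.zero_mem, by simp⟩
    obtain ⟨T₀, hT₀⟩ := Finset.nonempty_iff_ne_empty.mpr hXe
    -- the orbit of `T₀`
    set orb : Finset (Finset Γ) := Finset.univ.image fun g : Γ => T₀.image (g * ·) with horb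
    have horbX : orb ⊆ X := by
      intro T hT
      obtain ⟨g, -, rfl⟩ := Finset.mem_image.mp hT
      exact hX g T₀ hT₀
    have hinj : Function.Injective fun g : Γ => T₀.image (g * ·) := by
      intro g h hgh
      by_contra hne
      have h1 : (h⁻¹ * g) ≠ 1 := fun h' => hne (by
        rw [← mul_one h, ← h', mul_inv_cancel_left])
      refine hfree (h⁻¹ * g) h1 T₀ hT₀ ?_
      have := congrArg (fun T : Finset Γ => T.image (h⁻¹ * ·)) hgh
      simp only [htr_mul, inv_mul_cancel, htr_one] at this
      exact this
    have horbsum : ∑ T ∈ orb, f T = ∑ g : Γ, g • f T₀ := by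
      rw [horb, Finset.sum_image fun g _ h _ hgh => hinj hgh]
      exact Finset.sum_congr rfl fun g _ => hf g T₀
    -- the complement is stable, free, and smaller
    set X' := X \ orb with hX'
    have hX'sub : X' ⊂ X := by
      refine Finset.sdiff_ssubset horbX ⟨T₀, ?_⟩
      exact Finset.mem_image.mpr ⟨1, Finset.mem_univ _, htr_one T₀⟩
    have hX'stab : ∀ (g : Γ), ∀ T ∈ X', T.image (g * ·) ∈ X' := by
      intro g T hT
      rw [hX', Finset.mem_sdiff] at hT ⊢
      refine ⟨hX g T hT.1, fun hmem => hT.2 ?_⟩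
      obtain ⟨k, -, hk⟩ := Finset.mem_image.mp hmem
      refine Finset.mem_image.mpr ⟨g⁻¹ * k, Finset.mem_univ _, ?_⟩
      have := congrArg (fun T : Finset Γ => T.image (g⁻¹ * ·)) hk
      simp only [htr_mul, inv_mul_cancel, htr_one] at this
      exact this
    obtain ⟨w', hw'P, hw'⟩ := ih X' hX'sub hX'stab
      (fun g hg T hT => hfree g hg T (Finset.mem_sdiff.mp hT).1)
      (fun T hT => hP T (Finset.mem_sdiff.mp hT).1)
    refine ⟨f T₀ + w', P.add_mem (hP T₀ hT₀) hw'P, ?_⟩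
    rw [← Finset.sum_sdiff horbX, ← hX', hw', horbsum, ← Finset.sum_add_distrib]
    exact Finset.sum_congr rfl fun g _ => by rw [smul_add, add_comm]

end Orbits

/-! ### Serre V §3 Lemma 5: `N(1 + y) ≡ 1 + Tr(y) + N(y) mod Tr(𝔓^{2m})` -/

section Lemma5

variable (R : Type*) {K L : Type*} [CommRing R] [Field K] [Field L] [Algebra R K] [Algebra R L]
  [Algebra K L] [IsScalarTower R K L]
  (F : IntermediateField K L) (𝔓 : Ideal (integralClosure R L))

/-- Translation-invariant subsets of a group of prime order are trivial: if `g ≠ 1` and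
`g T = T` then `T = ∅` or `T = Γ` (the stabiliser of `T` is a subgroup containing `g`, hence all
of `Γ`).  Ref: Serre, *Local Fields*, Ch. V §3, proof of Lemma 5 ("if `u = us` then `u` is a
multiple of the norm"). [folklore] -/
theorem image_mul_left_ne_of_prime_card {Γ : Type*} [Group Γ] [Fintype Γ] [DecidableEq Γ]
    (hℓ : (Fintype.card Γ).Prime) {g : Γ} (hg : g ≠ 1) {T : Finset Γ} (hT : T ≠ ∅)
    (hT' : T ≠ Finset.univ) : T.image (g * ·) ≠ T := by
  intro hgT
  -- the stabiliser of `T` is a subgroup containing `g`, hence everything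
  let Stab : Subgroup Γ :=
    { carrier := {h | T.image (h * ·) = T}
      mul_mem' := fun {a b} ha hb => by
        change T.image ((a * b) * ·) = T
        have hab : T.image ((a * b) * ·) = (T.image (b * ·)).image (a * ·) := by
          rw [Finset.image_image]
          exact Finset.image_congr fun x _ => mul_assoc a b x
        rw [hab, show T.image (b * ·) = T from hb]
        exact ha
      one_mem' := by
        change T.image ((1 : Γ) * ·) = T
        simp only [one_mul, Finset.image_id']
      inv_mem' := fun {a} ha => by
        change T.image (a⁻¹ * ·) = T
        have h := congrArg (fun U : Finset Γ => U.image (a⁻¹ * ·)) (show T.image (a * ·) = T from ha)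
        simp only [Finset.image_image] at h
        rw [← h]
        conv_rhs => rw [← Finset.image_id' (s := T)]
        refine (Finset.image_congr fun x _ => ?_).symm
        simp [Function.comp] }
  haveI : Fact (Fintype.card Γ).Prime := ⟨hℓ⟩
  have htop : Subgroup.zpowers g = ⊤ :=
    zpowers_eq_top_of_prime_card (p := Fintype.card Γ) Nat.card_eq_fintype_card hg
  have hall : ∀ h : Γ, T.image (h * ·) = T := fun h => by
    have hmem : h ∈ Stab := by
      have : Subgroup.zpowers g ≤ Stab := (Subgroup.zpowers_le (G := Γ)).mpr hgT
      rw [htop] at this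
      exact this (Subgroup.mem_top h)
    exact hmem
  obtain ⟨t, ht⟩ := Finset.nonempty_iff_ne_empty.mpr hT
  refine hT' (Finset.eq_univ_iff_forall.mpr fun γ => ?_)
  rw [← hall (γ * t⁻¹)]
  exact Finset.mem_image.mpr ⟨t, ht, by rw [inv_mul_cancel_right]⟩

/-- **Serre V §3 Lemma 5** (the norm of a principal unit in a cyclic layer of prime degree).
Let `Γ = Gal(L/F)` have prime order `ℓ` and fix `𝔓` (`Γ ≤ T_𝔓`).  For `y ∈ 𝔓 ^ m`:
`N(1 + y) = 1 + Tr(y) + N(y) + Tr(w)` for some `w ∈ 𝔓 ^ (2m)`.  Proof (Serre's): expanding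
`∏_{γ} (1 + γ y) = Σ_{T ⊆ Γ} ∏_{γ ∈ T} γ y`, the terms `T = ∅`, `|T| = 1`, `T = Γ` give
`1`, `Tr(y)`, `N(y)`; `Γ` acts freely on the remaining `T` (`2 ≤ |T| ≤ ℓ - 1`, by
`image_mul_left_ne_of_prime_card`), and the sum over an orbit is the trace of a product of
`≥ 2` conjugates of `y`.
Ref: Serre, *Local Fields*, Ch. V §3, Lemma 5 (pp. 83–84). [cite: SerreLocalFields1979, Ch. V §3 Lemma 5] -/
theorem norm_one_add_eq [Fintype F.fixingSubgroup] [DecidableEq F.fixingSubgroup]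
    (hℓ : (Fintype.card F.fixingSubgroup).Prime)
    (hF : F.fixingSubgroup ≤ 𝔓.inertia (L ≃ₐ[K] L)) {m : ℕ} {y : integralClosure R L}
    (hy : y ∈ 𝔓 ^ m) :
    ∃ w ∈ 𝔓 ^ (2 * m), ∏ γ : F.fixingSubgroup, (1 + (γ : L ≃ₐ[K] L) • y) =
      1 + ∑ γ : F.fixingSubgroup, (γ : L ≃ₐ[K] L) • y +
        ∏ γ : F.fixingSubgroup, (γ : L ≃ₐ[K] L) • y +
        ∑ γ : F.fixingSubgroup, (γ : L ≃ₐ[K] L) • w := by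
  have hstab : ∀ g : F.fixingSubgroup, g • 𝔓 = 𝔓 := fun g =>
    (Ideal.inertia_le_stabilizer 𝔓) (hF g.2)
  have hℓ2 : 2 ≤ Fintype.card F.fixingSubgroup := hℓ.two_le
  -- the function `f(T) = ∏_{γ ∈ T} γ y` and the set `X` of "middle" subsets
  set f : Finset F.fixingSubgroup → integralClosure R L := fun T => ∏ γ ∈ T, (γ : L ≃ₐ[K] L) • y
    with hf
  set X : Finset (Finset F.fixingSubgroup) := (Finset.univ : Finset F.fixingSubgroup).powerset.filter
    fun T => T ≠ ∅ ∧ T ≠ Finset.univ ∧ T.card ≠ 1 with hX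
  -- equivariance, stability, freeness, values in `𝔓 ^ (2m)`
  have hfeq : ∀ (g : F.fixingSubgroup) (T : Finset F.fixingSubgroup),
      f (T.image (g * ·)) = g • f T := fun g T => by
    simp only [hf]
    rw [Finset.prod_image fun a _ b _ h => mul_left_cancel h, Finset.smul_prod']
    refine Finset.prod_congr rfl fun γ _ => ?_
    rw [Subgroup.coe_mul, mul_smul]
    rfl
  have hcard_image : ∀ (g : F.fixingSubgroup) (T : Finset F.fixingSubgroup),
      (T.image (g * ·)).card = T.card := fun g T =>
    Finset.card_image_of_injective _ (mul_right_injective g)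
  have hXstab : ∀ (g : F.fixingSubgroup), ∀ T ∈ X, T.image (g * ·) ∈ X := by
    intro g T hT
    simp only [hX, Finset.mem_filter, Finset.mem_powerset] at hT ⊢
    refine ⟨Finset.subset_univ _, ?_, ?_, ?_⟩
    · rw [Ne, Finset.image_eq_empty]; exact hT.2.1
    · intro h
      apply hT.2.2.1
      rw [← Finset.card_eq_iff_eq_univ, ← hcard_image g T, h, Finset.card_univ]
    · rw [hcard_image]; exact hT.2.2.2
  have hXfree : ∀ (g : F.fixingSubgroup), g ≠ 1 → ∀ T ∈ X, T.image (g * ·) ≠ T := by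
    intro g hg T hT
    simp only [hX, Finset.mem_filter] at hT
    exact image_mul_left_ne_of_prime_card hℓ hg hT.2.1 hT.2.2.1
  have hXP : ∀ T ∈ X, f T ∈ (𝔓 ^ (2 * m)).toAddSubmonoid := by
    intro T hT
    simp only [hX, Finset.mem_filter] at hT
    have hcard : 2 ≤ T.card := by
      have h0 : T.card ≠ 0 := fun h => hT.2.1 (Finset.card_eq_zero.mp h)
      have h1 := hT.2.2.2
      omega
    change f T ∈ 𝔓 ^ (2 * m)
    have hmem : f T ∈ ∏ γ ∈ T, 𝔓 ^ m :=
      Ideal.prod_mem_prod fun γ _ => smul_mem_pow_of_smul_eq 𝔓 (hstab γ) hy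
    rw [Finset.prod_const, ← pow_mul] at hmem
    exact Ideal.pow_le_pow_right (by nlinarith) hmem
  obtain ⟨w, hwP, hw⟩ := exists_sum_eq_sum_smul_of_free (𝔓 ^ (2 * m)).toAddSubmonoid f hfeq X
    hXstab hXfree hXP
  refine ⟨w, hwP, ?_⟩
  -- split the expansion of `∏ (1 + γ y)` into the two parts
  rw [Finset.prod_one_add, ← Finset.sum_filter_add_sum_filter_not _
    (fun T => T ≠ ∅ ∧ T ≠ Finset.univ ∧ T.card ≠ 1)]
  change ∑ T ∈ X, f T + _ = _
  rw [hw]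
  -- the exceptional subsets `∅`, `Γ`, and the singletons
  have hexc : (Finset.univ : Finset F.fixingSubgroup).powerset.filter
      (fun T => ¬ (T ≠ ∅ ∧ T ≠ Finset.univ ∧ T.card ≠ 1)) =
      insert ∅ (insert Finset.univ ((Finset.univ : Finset F.fixingSubgroup).powersetCard 1)) := by
    ext T
    simp only [Finset.mem_filter, Finset.mem_powerset, Finset.mem_insert, Finset.mem_powersetCard]
    constructor
    · rintro ⟨hsub, h⟩
      by_cases h0 : T = ∅
      · exact Or.inl h0
      by_cases hu : T = Finset.univ
      · exact Or.inr (Or.inl hu)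
      refine Or.inr (Or.inr ⟨hsub, ?_⟩)
      by_contra h1
      exact h ⟨h0, hu, h1⟩
    · rintro (h | h | ⟨hsub, h⟩)
      · exact ⟨by rw [h]; exact Finset.empty_subset _, fun h' => h'.1 h⟩
      · exact ⟨by rw [h], fun h' => h'.2.1 h⟩
      · exact ⟨hsub, fun h' => h'.2.2 h⟩
  have h0u : (∅ : Finset F.fixingSubgroup) ≠ Finset.univ := by
    intro h
    have := congrArg Finset.card h
    rw [Finset.card_empty, Finset.card_univ] at this
    omega
  have hnot1 : ∅ ∉ insert Finset.univ ((Finset.univ : Finset F.fixingSubgroup).powersetCard 1) := by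
    rw [Finset.mem_insert, Finset.mem_powersetCard]
    rintro (h | ⟨-, h⟩)
    · exact h0u h
    · rw [Finset.card_empty] at h; exact zero_ne_one h
  have hnot2 : (Finset.univ : Finset F.fixingSubgroup) ∉
      (Finset.univ : Finset F.fixingSubgroup).powersetCard 1 := by
    rw [Finset.mem_powersetCard, Finset.card_univ]
    rintro ⟨-, h⟩
    omega
  rw [hexc, Finset.sum_insert hnot1, Finset.sum_insert hnot2, Finset.prod_empty,
    Finset.powersetCard_one, Finset.sum_map]
  simp only [Function.Embedding.coeFn_mk, Finset.prod_singleton]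
  have hsmul : ∀ g : F.fixingSubgroup, g • w = (g : L ≃ₐ[K] L) • w := fun _ => rfl
  simp only [hsmul]
  ring

end Lemma5

/-! ### The jump `t`, the different exponent `(ℓ - 1)(t + 1)`, and auxiliary order lemmas -/

section Jump

variable (R : Type*) {K L : Type*} [CommRing R] [Field K] [Field L] [Algebra R K] [Algebra R L]
  [Algebra K L] [IsScalarTower R K L]

attribute [local instance] integralClosureAlgebra integralClosure_isScalarTower_left
  integralClosure_isScalarTower_bot integralClosure_faithfulSMul integralClosure_isIntegral
  integralClosure_isTorsionFree isMaximal_under_integralClosure under_integralClosure_liesOver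
  residueAlgebra residueSMul isScalarTower_residue

variable (F : IntermediateField K L) [IsDedekindDomain R] [IsFractionRing R K]
  [FiniteDimensional K L] [IsGalois K L]
  (𝔓 : Ideal (integralClosure R L)) [𝔓.IsMaximal]

/-- **Lemma 3 (the different of the layer).**  If `Γ ≤ G_t` and `Γ ∩ G_{t+1} = 1` (so `t` is
the jump of `Γ`: `i_G(γ) = t + 1` for `γ ∈ Γ ∖ 1`), the different exponent of the layer at `𝔓` is
`v_𝔓(f'(x)) = Σ_{γ ≠ 1} i_G(γ) = (|Γ| - 1)(t + 1)`.
Ref: Serre, *Local Fields*, Ch. V §3, Lemma 3 (`𝔇 = 𝔭_L^m`, `m = (t+1)(l-1)`).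
[cite: SerreLocalFields1979, Ch. V §3 Lemma 3] -/
theorem emultiplicity_aeval_derivative_generator_eq_of_jump [Fintype F.fixingSubgroup]
    [DecidableEq F.fixingSubgroup] (h𝔓 : 𝔓 ≠ ⊥)
    (hF : F.fixingSubgroup ≤ 𝔓.inertia (L ≃ₐ[K] L)) {t : ℕ}
    (ht : ∀ γ : F.fixingSubgroup, (γ : L ≃ₐ[K] L) ∈ 𝔓.ramificationSubgroup (L ≃ₐ[K] L) t)
    (ht1 : ∀ γ : F.fixingSubgroup, γ ≠ 1 →
      (γ : L ≃ₐ[K] L) ∉ 𝔓.ramificationSubgroup (L ≃ₐ[K] L) (t + 1))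
    {x : integralClosure R L} {d : integralClosure R F}
    (hd : algebraMap (integralClosure R F) (integralClosure R L) d ∉ 𝔓)
    (hgen : ∀ b : integralClosure R L, ∃ P : (integralClosure R F)[X], d • b = aeval x P) :
    emultiplicity 𝔓 (Ideal.span {aeval x (derivative (minpoly (integralClosure R F) x))}) =
      ((Fintype.card F.fixingSubgroup - 1) * (t + 1) : ℕ) := by
  rw [emultiplicity_aeval_derivative_generator R F 𝔓 h𝔓 hF hd hgen]
  have hi : ∀ γ ∈ (Finset.univ : Finset F.fixingSubgroup).erase 1,
      lowerIndex 𝔓 (L ≃ₐ[K] L) (γ : L ≃ₐ[K] L) = ((t + 1 : ℕ) : ℕ∞) := by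
    intro γ hγ
    have hγ1 : γ ≠ 1 := (Finset.mem_erase.mp hγ).1
    refine le_antisymm ?_ ?_
    · have h := (lowerIndex_le_natCast_iff 𝔓 (G := L ≃ₐ[K] L)).mpr (ht1 γ hγ1)
      exact_mod_cast h
    · have h := add_one_le_lowerIndex 𝔓 (ht γ)
      exact_mod_cast h
  rw [Finset.sum_congr rfl hi, Finset.sum_const, Finset.card_erase_of_mem (Finset.mem_univ _),
    Finset.card_univ, nsmul_eq_mul]
  push_cast
  ring

/-- `v_𝔓(y₀) = u` implies `𝔓^u ⊆ (y₀) + 𝔓^{u+1}` (the class of `y₀` generates the line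
`𝔓^u/𝔓^{u+1}`): `(y₀) = 𝔓^u 𝔞` with `𝔞 + 𝔓 = 1`.  Ref: Serre, *Local Fields*, Ch. I §3 /
Ch. IV §2 (the one-dimensional spaces `𝔭^n/𝔭^{n+1}`). [folklore] -/
theorem pow_le_span_sup_pow_succ {S : Type*} [CommRing S] [IsDedekindDomain S] (P : Ideal S)
    [P.IsMaximal] (hP : P ≠ ⊥) {y₀ : S} {u : ℕ} (hy₀ : ordIdeal P y₀ = u) :
    P ^ u ≤ Ideal.span {y₀} ⊔ P ^ (u + 1) := by
  have hprime : Prime P := Ideal.prime_of_isPrime hP inferInstance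
  have hfin : FiniteMultiplicity P (Ideal.span {y₀}) :=
    finiteMultiplicity_iff_emultiplicity_ne_top.mpr (by rw [hy₀]; exact ENat.coe_ne_top u)
  obtain ⟨𝔞, h𝔞, h𝔞P⟩ := hfin.exists_eq_pow_mul_and_not_dvd
  have hmu : multiplicity P (Ideal.span {y₀}) = u := by
    have h := hfin.emultiplicity_eq_multiplicity
    rw [hy₀] at h
    exact_mod_cast h.symm
  rw [hmu] at h𝔞
  have hcop : P ⊔ 𝔞 = ⊤ :=
    (Ideal.IsMaximal.out : IsCoatom P).2 _ (lt_of_le_of_ne le_sup_left fun h =>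
      h𝔞P (Ideal.dvd_iff_le.mpr (h ▸ le_sup_right)))
  apply le_of_eq
  calc P ^ u = P ^ u * (𝔞 ⊔ P) := by rw [sup_comm, hcop, Ideal.mul_top]
    _ = P ^ u * 𝔞 ⊔ P ^ u * P := Ideal.mul_sup _ _ _
    _ = Ideal.span {y₀} ⊔ P ^ (u + 1) := by rw [← h𝔞, pow_succ]

/-- From `ι(z₀) ∈ 𝔓 ^ (|Γ| k)` back to `z₀ ∈ 𝔓_F ^ k` (`v_𝔓 = |Γ| v_{𝔓_F}` on `S_F`, total
ramification).  Ref: Serre, *Local Fields*, Ch. I §4 (`v_𝔓 = e v_𝔭` on `K`). [folklore] -/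
theorem mem_under_pow_of_algebraMap_mem_pow [Fintype F.fixingSubgroup] (h𝔓 : 𝔓 ≠ ⊥)
    [Algebra.IsSeparable (R ⧸ 𝔓.under R) (integralClosure R L ⧸ 𝔓)]
    (hF : F.fixingSubgroup ≤ 𝔓.inertia (L ≃ₐ[K] L)) {z₀ : integralClosure R F} {k : ℕ}
    (hz : algebraMap (integralClosure R F) (integralClosure R L) z₀ ∈
      𝔓 ^ (Fintype.card F.fixingSubgroup * k)) :
    z₀ ∈ 𝔓.under (integralClosure R F) ^ k := by
  haveI : IsDedekindDomain (integralClosure R L) := integralClosure.isDedekindDomain R K L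
  haveI : IsDedekindDomain (integralClosure R F) := integralClosure.isDedekindDomain R K F
  haveI : Algebra.IsIntegral (integralClosure R F) (integralClosure R L) :=
    integralClosure_isIntegral R F
  haveI h𝔓prime : 𝔓.IsPrime := Ideal.IsMaximal.isPrime inferInstance
  have h𝔓F : 𝔓.under (integralClosure R F) ≠ ⊥ := Ideal.IsIntegral.comap_ne_bot _ h𝔓
  have hmap := map_under_eq_pow_card R F 𝔓 h𝔓 hF
  set n := Fintype.card F.fixingSubgroup with hn
  have hn0 : n ≠ 0 := Fintype.card_ne_zero
  have hemap : emultiplicity 𝔓 ((𝔓.under (integralClosure R F)).map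
      (algebraMap (integralClosure R F) (integralClosure R L))) = n := by
    rw [hmap, emultiplicity_pow_self h𝔓 (fun hu => Ideal.IsPrime.ne_top inferInstance
      (Ideal.isUnit_iff.mp hu))]
  have hord := ordIdeal_algebraMap (𝔓 := 𝔓) h𝔓 h𝔓F (by rw [hmap]; exact Ideal.pow_le_self hn0) z₀
  rw [hemap] at hord
  rw [← le_ordIdeal_iff_mem_pow] at hz ⊢
  rw [hord] at hz
  -- `n k ≤ v(z₀) n` gives `k ≤ v(z₀)`
  induction h : (ordIdeal (𝔓.under (integralClosure R F)) z₀) using ENat.recTopCoe with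
  | top => exact le_top
  | coe m =>
    rw [h] at hz
    have hz' : n * k ≤ m * n := by exact_mod_cast hz
    exact_mod_cast Nat.le_of_mul_le_mul_right (by rwa [mul_comm] at hz') (Nat.pos_of_ne_zero hn0)

end Jump

/-! ### Arithmetic of `ψ(j) = min(j,t) + ℓ (j - t)` and `d = (ℓ - 1)(t + 1)` -/

section PsiArith

/-- Elementary inequalities for Serre's `ψ` of a cyclic layer of prime degree `ℓ ≥ 2` with jump
`t` (`ψ(j) = j` for `j ≤ t`, `ψ(j) = t + ℓ(j - t)` for `j ≥ t`) and different exponent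
`d = (ℓ-1)(t+1)`: `ψ(j) ≥ j`, `ψ(j) + d ≥ ℓ j`, `ψ(j) + 1 + d ≥ ℓ (j + 1)` — the exponent
bookkeeping in the proof of Serre's Prop. V.4.  Ref: Serre, *Local Fields*, Ch. V §3, proof of
Props. 4–5 (cases ii)–iv)). [folklore] -/
theorem psi_le_and (ℓ t j : ℕ) (hℓ : 2 ≤ ℓ) :
    j ≤ min j t + ℓ * (j - t) ∧ ℓ * j ≤ min j t + ℓ * (j - t) + (ℓ - 1) * (t + 1) ∧
      ℓ * (j + 1) ≤ min j t + ℓ * (j - t) + 1 + (ℓ - 1) * (t + 1) := by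
  obtain ⟨ℓ₁, rfl⟩ : ∃ ℓ₁, ℓ = ℓ₁ + 2 := ⟨ℓ - 2, by omega⟩
  rw [show ℓ₁ + 2 - 1 = ℓ₁ + 1 by omega]
  rcases le_or_gt j t with hjt | hjt
  · rw [min_eq_left hjt, Nat.sub_eq_zero_of_le hjt, mul_zero, add_zero]
    refine ⟨le_rfl, ?_, ?_⟩ <;> nlinarith [Nat.mul_le_mul_left ℓ₁ hjt]
  · rw [min_eq_right hjt.le]
    obtain ⟨k, rfl⟩ : ∃ k, j = t + k := ⟨j - t, by omega⟩
    rw [Nat.add_sub_cancel_left]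
    refine ⟨?_, ?_, ?_⟩ <;> nlinarith

/-- For `j < t`: `j + d ≥ ℓ (j + 1)` (the trace of `𝔓^j` is already in `𝔓_F^{j+1}`; Serre's
case ii), `r = [n + 2 - 2/l] ≥ n + 1`). [folklore] -/
theorem mul_succ_le_of_lt_jump (ℓ t j : ℕ) (hℓ : 2 ≤ ℓ) (hjt : j < t) :
    ℓ * (j + 1) ≤ j + (ℓ - 1) * (t + 1) := by
  obtain ⟨ℓ₁, rfl⟩ : ∃ ℓ₁, ℓ = ℓ₁ + 2 := ⟨ℓ - 2, by omega⟩
  rw [show ℓ₁ + 2 - 1 = ℓ₁ + 1 by omega]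
  obtain ⟨k, rfl⟩ : ∃ k, t = j + k + 1 := ⟨t - j - 1, by omega⟩
  nlinarith

/-- For `t < j`: `ψ(j) ≥ j + 1`. [folklore] -/
theorem succ_le_psi_of_jump_lt (ℓ t j : ℕ) (hℓ : 2 ≤ ℓ) (hjt : t < j) :
    j + 1 ≤ min j t + ℓ * (j - t) := by
  rw [min_eq_right hjt.le]
  obtain ⟨k, rfl⟩ : ∃ k, j = t + k + 1 := ⟨j - t - 1, by omega⟩
  rw [show t + k + 1 - t = k + 1 by omega]
  nlinarith

/-- For `t ≤ j`: `ψ(j) + d = ℓ j + (ℓ - 1)`, so that `⌊(ψ(j) + d)/ℓ⌋ = j` (Serre's case iv)).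
[folklore] -/
theorem psi_add_eq_of_jump_le (ℓ t j : ℕ) (hℓ : 2 ≤ ℓ) (hjt : t ≤ j) :
    min j t + ℓ * (j - t) + (ℓ - 1) * (t + 1) = ℓ * j + (ℓ - 1) ∧
      (min j t + ℓ * (j - t) + (ℓ - 1) * (t + 1)) / ℓ = j := by
  obtain ⟨ℓ₁, rfl⟩ : ∃ ℓ₁, ℓ = ℓ₁ + 2 := ⟨ℓ - 2, by omega⟩
  rw [show ℓ₁ + 2 - 1 = ℓ₁ + 1 by omega, min_eq_right hjt]
  obtain ⟨k, rfl⟩ : ∃ k, j = t + k := ⟨j - t, by omega⟩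
  rw [Nat.add_sub_cancel_left]
  have h : t + (ℓ₁ + 2) * k + (ℓ₁ + 1) * (t + 1) = (ℓ₁ + 2) * (t + k) + (ℓ₁ + 1) := by ring
  refine ⟨h, ?_⟩
  rw [h, Nat.mul_add_div (by omega), Nat.div_eq_of_lt (by omega), add_zero]

end PsiArith

/-! ### Serre V §3 Props. 4–5: the norm on the unit filtration -/

section Prop45

variable (R : Type*) {K L : Type*} [CommRing R] [Field K] [Field L] [Algebra R K] [Algebra R L]
  [Algebra K L] [IsScalarTower R K L]

attribute [local instance] integralClosureAlgebra integralClosure_isScalarTower_left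
  integralClosure_isScalarTower_bot integralClosure_faithfulSMul integralClosure_isIntegral
  integralClosure_isTorsionFree isMaximal_under_integralClosure under_integralClosure_liesOver
  residueAlgebra residueSMul isScalarTower_residue

variable (F : IntermediateField K L) [IsDedekindDomain R] [IsFractionRing R K]
  [FiniteDimensional K L] [IsGalois K L]
  (𝔓 : Ideal (integralClosure R L)) [𝔓.IsMaximal]

/-- The trace estimate of the layer, with the different exponent `(ℓ-1)(t+1)` made explicit:
`y ∈ 𝔓 ^ v ⟹ Tr_Γ(y) ∈ 𝔓 ^ (ℓ ⌊(v + (ℓ-1)(t+1))/ℓ⌋)`.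
Ref: Serre, *Local Fields*, Ch. V §3, Lemmas 3–4. [cite: SerreLocalFields1979, Ch. V §3 Lemma 4] -/
theorem sum_smul_mem_pow_of_jump [Fintype F.fixingSubgroup] [DecidableEq F.fixingSubgroup]
    (h𝔓 : 𝔓 ≠ ⊥) [Algebra.IsSeparable (R ⧸ 𝔓.under R) (integralClosure R L ⧸ 𝔓)]
    (hF : F.fixingSubgroup ≤ 𝔓.inertia (L ≃ₐ[K] L)) {t : ℕ}
    (ht : ∀ γ : F.fixingSubgroup, (γ : L ≃ₐ[K] L) ∈ 𝔓.ramificationSubgroup (L ≃ₐ[K] L) t)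
    (ht1 : ∀ γ : F.fixingSubgroup, γ ≠ 1 →
      (γ : L ≃ₐ[K] L) ∉ 𝔓.ramificationSubgroup (L ≃ₐ[K] L) (t + 1))
    {v : ℕ} {y : integralClosure R L} (hy : y ∈ 𝔓 ^ v) :
    ∑ γ : F.fixingSubgroup, (γ : L ≃ₐ[K] L) • y ∈
      𝔓 ^ (Fintype.card F.fixingSubgroup *
        ((v + (Fintype.card F.fixingSubgroup - 1) * (t + 1)) / Fintype.card F.fixingSubgroup)) := by
  obtain ⟨x, d, -, hd, hgen⟩ := exists_generator_mem R F 𝔓 h𝔓 hF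
  exact sum_smul_mem_pow_of_mem_pow R F 𝔓 h𝔓 hF hd hgen
    (emultiplicity_aeval_derivative_generator_eq_of_jump R F 𝔓 h𝔓 hF ht ht1 hd hgen) hy

omit [IsDedekindDomain R] [IsFractionRing R K] [FiniteDimensional K L] [IsGalois K L]
  [𝔓.IsMaximal] in
/-- The norm `N_Γ(y) = ∏ γ y` of `y ∈ 𝔓 ^ v` lies in `𝔓 ^ (|Γ| v)` (`Γ` fixes `𝔓`). [folklore] -/
theorem prod_smul_mem_pow [Fintype F.fixingSubgroup]
    (hF : F.fixingSubgroup ≤ 𝔓.inertia (L ≃ₐ[K] L)) {v : ℕ} {y : integralClosure R L}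
    (hy : y ∈ 𝔓 ^ v) :
    ∏ γ : F.fixingSubgroup, (γ : L ≃ₐ[K] L) • y ∈ 𝔓 ^ (Fintype.card F.fixingSubgroup * v) := by
  have hstab : ∀ g : F.fixingSubgroup, g • 𝔓 = 𝔓 := fun g =>
    (Ideal.inertia_le_stabilizer 𝔓) (hF g.2)
  have hmem : ∏ γ : F.fixingSubgroup, (γ : L ≃ₐ[K] L) • y ∈ ∏ _γ : F.fixingSubgroup, 𝔓 ^ v :=
    Ideal.prod_mem_prod fun γ _ => smul_mem_pow_of_smul_eq 𝔓 (hstab γ) hy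
  rwa [Finset.prod_const, Finset.card_univ, ← pow_mul, mul_comm] at hmem

/-- **Serre V §3 Prop. 4, first inclusion: `N(U_L^{ψ(j)}) ⊆ U_F^j`.**  For the cyclic layer
`L/F` of prime degree `ℓ = |Γ|`, totally ramified at `𝔓` with jump `t`, and `y ∈ 𝔓 ^ ψ(j)`
(`ψ(j) = min(j,t) + ℓ(j - t)`): `N_Γ(1 + y) - 1 ∈ 𝔓 ^ (ℓ j)`, i.e. `N(1 + y) ∈ U_F^j`.
Proof: Lemma 5 and Lemma 4 (`Tr(y), Tr(w) ∈ 𝔓_F^j`, `N(y) ∈ 𝔓_F^{ψ(j)} ⊆ 𝔓_F^j`).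
Ref: Serre, *Local Fields*, Ch. V §3, Prop. 4 (p. 84). [cite: SerreLocalFields1979, Ch. V §3 Prop. 4] -/
theorem prod_one_add_smul_sub_one_mem_pow [Fintype F.fixingSubgroup] [DecidableEq F.fixingSubgroup]
    (h𝔓 : 𝔓 ≠ ⊥) [Algebra.IsSeparable (R ⧸ 𝔓.under R) (integralClosure R L ⧸ 𝔓)]
    (hF : F.fixingSubgroup ≤ 𝔓.inertia (L ≃ₐ[K] L))
    (hℓ : (Fintype.card F.fixingSubgroup).Prime) {t : ℕ}
    (ht : ∀ γ : F.fixingSubgroup, (γ : L ≃ₐ[K] L) ∈ 𝔓.ramificationSubgroup (L ≃ₐ[K] L) t)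
    (ht1 : ∀ γ : F.fixingSubgroup, γ ≠ 1 →
      (γ : L ≃ₐ[K] L) ∉ 𝔓.ramificationSubgroup (L ≃ₐ[K] L) (t + 1))
    {j : ℕ} {y : integralClosure R L}
    (hy : y ∈ 𝔓 ^ (min j t + Fintype.card F.fixingSubgroup * (j - t))) :
    ∏ γ : F.fixingSubgroup, (1 + (γ : L ≃ₐ[K] L) • y) - 1 ∈
      𝔓 ^ (Fintype.card F.fixingSubgroup * j) := by
  set ℓ := Fintype.card F.fixingSubgroup with hℓdef
  clear_value ℓ
  have hℓcard : (Fintype.card F.fixingSubgroup).Prime := by rw [← hℓdef]; exact hℓ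
  have hℓ2 : 2 ≤ ℓ := hℓ.two_le
  have hℓpos : 0 < ℓ := by omega
  obtain ⟨hψ1, hψ2, -⟩ := psi_le_and ℓ t j hℓ2
  obtain ⟨w, hw, hN⟩ := norm_one_add_eq R F 𝔓 hℓcard hF hy
  rw [hN, show (1 : integralClosure R L) + ∑ γ : F.fixingSubgroup, (γ : L ≃ₐ[K] L) • y +
      ∏ γ : F.fixingSubgroup, (γ : L ≃ₐ[K] L) • y + ∑ γ : F.fixingSubgroup, (γ : L ≃ₐ[K] L) • w - 1 =
      ∑ γ : F.fixingSubgroup, (γ : L ≃ₐ[K] L) • y + ∏ γ : F.fixingSubgroup, (γ : L ≃ₐ[K] L) • y +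
      ∑ γ : F.fixingSubgroup, (γ : L ≃ₐ[K] L) • w by ring]
  have hTy := sum_smul_mem_pow_of_jump R F 𝔓 h𝔓 hF ht ht1 hy
  have hTw := sum_smul_mem_pow_of_jump R F 𝔓 h𝔓 hF ht ht1 hw
  have hNy := prod_smul_mem_pow R F 𝔓 hF hy
  rw [← hℓdef] at hTy hTw hNy
  refine Ideal.add_mem _ (Ideal.add_mem _ ?_ ?_) ?_
  · refine Ideal.pow_le_pow_right ?_ hTy
    exact Nat.mul_le_mul_left ℓ ((Nat.le_div_iff_mul_le hℓpos).mpr (by rw [mul_comm]; exact hψ2))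
  · exact Ideal.pow_le_pow_right (Nat.mul_le_mul_left ℓ hψ1) hNy
  · refine Ideal.pow_le_pow_right ?_ hTw
    refine Nat.mul_le_mul_left ℓ ((Nat.le_div_iff_mul_le hℓpos).mpr ?_)
    rw [mul_comm]
    omega

/-- **Serre V §3 Prop. 4, second inclusion: `N(U_L^{ψ(j)+1}) ⊆ U_F^{j+1}`.**  With notation as
in `prod_one_add_smul_sub_one_mem_pow`, for `y ∈ 𝔓 ^ (ψ(j) + 1)`:
`N_Γ(1 + y) - 1 ∈ 𝔓 ^ (ℓ (j + 1))`.
Ref: Serre, *Local Fields*, Ch. V §3, Prop. 4 (p. 84). [cite: SerreLocalFields1979, Ch. V §3 Prop. 4] -/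
theorem prod_one_add_smul_sub_one_mem_pow_succ [Fintype F.fixingSubgroup]
    [DecidableEq F.fixingSubgroup]
    (h𝔓 : 𝔓 ≠ ⊥) [Algebra.IsSeparable (R ⧸ 𝔓.under R) (integralClosure R L ⧸ 𝔓)]
    (hF : F.fixingSubgroup ≤ 𝔓.inertia (L ≃ₐ[K] L))
    (hℓ : (Fintype.card F.fixingSubgroup).Prime) {t : ℕ}
    (ht : ∀ γ : F.fixingSubgroup, (γ : L ≃ₐ[K] L) ∈ 𝔓.ramificationSubgroup (L ≃ₐ[K] L) t)
    (ht1 : ∀ γ : F.fixingSubgroup, γ ≠ 1 →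
      (γ : L ≃ₐ[K] L) ∉ 𝔓.ramificationSubgroup (L ≃ₐ[K] L) (t + 1))
    {j : ℕ} {y : integralClosure R L}
    (hy : y ∈ 𝔓 ^ (min j t + Fintype.card F.fixingSubgroup * (j - t) + 1)) :
    ∏ γ : F.fixingSubgroup, (1 + (γ : L ≃ₐ[K] L) • y) - 1 ∈
      𝔓 ^ (Fintype.card F.fixingSubgroup * (j + 1)) := by
  set ℓ := Fintype.card F.fixingSubgroup with hℓdef
  clear_value ℓ
  have hℓcard : (Fintype.card F.fixingSubgroup).Prime := by rw [← hℓdef]; exact hℓ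
  have hℓ2 : 2 ≤ ℓ := hℓ.two_le
  have hℓpos : 0 < ℓ := by omega
  obtain ⟨hψ1, -, hψ3⟩ := psi_le_and ℓ t j hℓ2
  obtain ⟨w, hw, hN⟩ := norm_one_add_eq R F 𝔓 hℓcard hF hy
  rw [hN, show (1 : integralClosure R L) + ∑ γ : F.fixingSubgroup, (γ : L ≃ₐ[K] L) • y +
      ∏ γ : F.fixingSubgroup, (γ : L ≃ₐ[K] L) • y + ∑ γ : F.fixingSubgroup, (γ : L ≃ₐ[K] L) • w - 1 =
      ∑ γ : F.fixingSubgroup, (γ : L ≃ₐ[K] L) • y + ∏ γ : F.fixingSubgroup, (γ : L ≃ₐ[K] L) • y +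
      ∑ γ : F.fixingSubgroup, (γ : L ≃ₐ[K] L) • w by ring]
  have hTy := sum_smul_mem_pow_of_jump R F 𝔓 h𝔓 hF ht ht1 hy
  have hTw := sum_smul_mem_pow_of_jump R F 𝔓 h𝔓 hF ht ht1 hw
  have hNy := prod_smul_mem_pow R F 𝔓 hF hy
  rw [← hℓdef] at hTy hTw hNy
  refine Ideal.add_mem _ (Ideal.add_mem _ ?_ ?_) ?_
  · refine Ideal.pow_le_pow_right ?_ hTy
    refine Nat.mul_le_mul_left ℓ ((Nat.le_div_iff_mul_le hℓpos).mpr ?_)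
    rw [mul_comm]
    omega
  · exact Ideal.pow_le_pow_right (Nat.mul_le_mul_left ℓ (by omega)) hNy
  · refine Ideal.pow_le_pow_right ?_ hTw
    refine Nat.mul_le_mul_left ℓ ((Nat.le_div_iff_mul_le hℓpos).mpr ?_)
    rw [mul_comm]
    omega

end Prop45

section Prop5

variable (R : Type*) {K L : Type*} [CommRing R] [Field K] [Field L] [Algebra R K] [Algebra R L]
  [Algebra K L] [IsScalarTower R K L]

attribute [local instance] integralClosureAlgebra integralClosure_isScalarTower_left
  integralClosure_isScalarTower_bot integralClosure_faithfulSMul integralClosure_isIntegral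
  integralClosure_isTorsionFree isMaximal_under_integralClosure under_integralClosure_liesOver
  residueAlgebra residueSMul isScalarTower_residue

variable (F : IntermediateField K L) [IsDedekindDomain R] [IsFractionRing R K]
  [FiniteDimensional K L] [IsGalois K L]
  (𝔓 : Ideal (integralClosure R L)) [𝔓.IsMaximal]

omit [IsDedekindDomain R] [IsFractionRing R K] [FiniteDimensional K L] [IsGalois K L] in
/-- The trace is `S_F`-linear: `Tr_Γ(a y) = a Tr_Γ(y)` for `Γ`-invariant `a`. [folklore] -/
theorem sum_smul_mul_of_invariant [Fintype F.fixingSubgroup] {a : integralClosure R L}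
    (ha : ∀ γ : F.fixingSubgroup, (γ : L ≃ₐ[K] L) • a = a) (y : integralClosure R L) :
    ∑ γ : F.fixingSubgroup, (γ : L ≃ₐ[K] L) • (a * y) =
      a * ∑ γ : F.fixingSubgroup, (γ : L ≃ₐ[K] L) • y := by
  rw [Finset.mul_sum]
  exact Finset.sum_congr rfl fun γ _ => by rw [smul_mul', ha γ]

set_option maxHeartbeats 800000 in
/-- **Serre V §3 Prop. 5 ii) and iv) (injectivity of `N_j` off the jump), Cor. 1.**  For the
cyclic layer `L/F` of prime degree `ℓ`, totally ramified at `𝔓` with jump `t`, and `j ≠ t`: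
if `y ∈ 𝔓 ^ ψ(j)` and `N_Γ(1 + y) ∈ U_F^{j+1}` then `y ∈ 𝔓 ^ (ψ(j) + 1)`.  For `j < t`
(`ψ(j) = j`): `N(1+y) ≡ 1 + N(y) mod 𝔓_F^{j+1}` and `v_𝔓(N y) = ℓ v_𝔓(y)` (Serre:
`N_j(ξ) = α_j ξ^p` is injective).  For `j > t`: `N(1+y) ≡ 1 + Tr(y) mod 𝔓_F^{j+1}` and `Tr`
induces a *bijection* `𝔓^{ψ(j)}/𝔓^{ψ(j)+1} → 𝔓_F^j/𝔓_F^{j+1}` of lines over the common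
residue field (surjective by Lemma 4, `exists_sum_smul_sub_mem_pow`; a class `y ≡ a y₀` with
`a` an inertia-fixed representative; Serre: `N_j(ξ) = β_j ξ`, `β_j ≠ 0`).
Ref: Serre, *Local Fields*, Ch. V §3, Prop. 5 ii), iv) and Cor. 1 (pp. 84–85).
[cite: SerreLocalFields1979, Ch. V §3 Prop. 5] -/
theorem mem_pow_succ_of_prod_one_add_smul_sub_one_mem [Fintype F.fixingSubgroup]
    [DecidableEq F.fixingSubgroup]
    (h𝔓 : 𝔓 ≠ ⊥) [Algebra.IsSeparable (R ⧸ 𝔓.under R) (integralClosure R L ⧸ 𝔓)]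
    (hF : F.fixingSubgroup ≤ 𝔓.inertia (L ≃ₐ[K] L))
    (hℓ : (Fintype.card F.fixingSubgroup).Prime) {t : ℕ}
    (ht : ∀ γ : F.fixingSubgroup, (γ : L ≃ₐ[K] L) ∈ 𝔓.ramificationSubgroup (L ≃ₐ[K] L) t)
    (ht1 : ∀ γ : F.fixingSubgroup, γ ≠ 1 →
      (γ : L ≃ₐ[K] L) ∉ 𝔓.ramificationSubgroup (L ≃ₐ[K] L) (t + 1))
    {j : ℕ} (hjt : j ≠ t) {y : integralClosure R L}
    (hy : y ∈ 𝔓 ^ (min j t + Fintype.card F.fixingSubgroup * (j - t)))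
    (hN : ∏ γ : F.fixingSubgroup, (1 + (γ : L ≃ₐ[K] L) • y) - 1 ∈
      𝔓 ^ (Fintype.card F.fixingSubgroup * (j + 1))) :
    y ∈ 𝔓 ^ (min j t + Fintype.card F.fixingSubgroup * (j - t) + 1) := by
  haveI : IsDedekindDomain (integralClosure R L) := integralClosure.isDedekindDomain R K L
  haveI h𝔓prime : 𝔓.IsPrime := Ideal.IsMaximal.isPrime inferInstance
  have hstab : ∀ g : F.fixingSubgroup, g • 𝔓 = 𝔓 := fun g =>
    (Ideal.inertia_le_stabilizer 𝔓) (hF g.2)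
  set ℓ := Fintype.card F.fixingSubgroup with hℓdef
  clear_value ℓ
  have hℓcard : (Fintype.card F.fixingSubgroup).Prime := by rw [← hℓdef]; exact hℓ
  have hℓ2 : 2 ≤ ℓ := hℓ.two_le
  have hℓpos : 0 < ℓ := by omega
  obtain ⟨hψ1, hψ2, hψ3⟩ := psi_le_and ℓ t j hℓ2
  set u := min j t + ℓ * (j - t) with hu
  obtain ⟨w, hw, hNeq⟩ := norm_one_add_eq R F 𝔓 hℓcard hF hy
  have hNeq' : ∏ γ : F.fixingSubgroup, (1 + (γ : L ≃ₐ[K] L) • y) - 1 =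
      ∑ γ : F.fixingSubgroup, (γ : L ≃ₐ[K] L) • y + ∏ γ : F.fixingSubgroup, (γ : L ≃ₐ[K] L) • y +
      ∑ γ : F.fixingSubgroup, (γ : L ≃ₐ[K] L) • w := by rw [hNeq]; ring
  rw [hNeq'] at hN
  have hTw := sum_smul_mem_pow_of_jump R F 𝔓 h𝔓 hF ht ht1 hw
  rw [← hℓdef] at hTw
  rcases Nat.lt_or_gt_of_ne hjt with hjt' | hjt'
  · ------------------------------------------------------------------
    -- `j < t`: `ψ(j) = j`, and `N(y) ∈ 𝔓^{ℓ(j+1)}` forces `v(y) ≥ j + 1`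
    ------------------------------------------------------------------
    have huj : u = j := by rw [hu, min_eq_left hjt'.le, Nat.sub_eq_zero_of_le hjt'.le, mul_zero, add_zero]
    rw [huj] at hy hw hTw ⊢
    have hA := mul_succ_le_of_lt_jump ℓ t j hℓ2 hjt'
    have hTy := sum_smul_mem_pow_of_jump R F 𝔓 h𝔓 hF ht ht1 hy
    rw [← hℓdef] at hTy
    have hTy' : ∑ γ : F.fixingSubgroup, (γ : L ≃ₐ[K] L) • y ∈ 𝔓 ^ (ℓ * (j + 1)) := by
      refine Ideal.pow_le_pow_right (Nat.mul_le_mul_left ℓ ((Nat.le_div_iff_mul_le hℓpos).mpr ?_)) hTy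
      rw [mul_comm]; exact hA
    have hTw' : ∑ γ : F.fixingSubgroup, (γ : L ≃ₐ[K] L) • w ∈ 𝔓 ^ (ℓ * (j + 1)) := by
      refine Ideal.pow_le_pow_right (Nat.mul_le_mul_left ℓ ((Nat.le_div_iff_mul_le hℓpos).mpr ?_)) hTw
      rw [mul_comm]; omega
    have hNy : ∏ γ : F.fixingSubgroup, (γ : L ≃ₐ[K] L) • y ∈ 𝔓 ^ (ℓ * (j + 1)) := by
      have h := Ideal.sub_mem _ (Ideal.sub_mem _ hN hTy') hTw'
      rwa [show ∑ γ : F.fixingSubgroup, (γ : L ≃ₐ[K] L) • y + ∏ γ : F.fixingSubgroup, (γ : L ≃ₐ[K] L) • y +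
        ∑ γ : F.fixingSubgroup, (γ : L ≃ₐ[K] L) • w - ∑ γ : F.fixingSubgroup, (γ : L ≃ₐ[K] L) • y -
        ∑ γ : F.fixingSubgroup, (γ : L ≃ₐ[K] L) • w = ∏ γ : F.fixingSubgroup, (γ : L ≃ₐ[K] L) • y by ring] at h
    -- `v(N y) = ℓ v(y)`
    rw [← le_ordIdeal_iff_mem_pow, ordIdeal_prod h𝔓,
      Finset.sum_congr rfl fun (γ : F.fixingSubgroup) _ =>
        show ordIdeal 𝔓 ((γ : L ≃ₐ[K] L) • y) = ordIdeal 𝔓 y from ordIdeal_smul (hstab γ) y,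
      Finset.sum_const, Finset.card_univ, ← hℓdef] at hNy
    rw [← le_ordIdeal_iff_mem_pow]
    induction h : ordIdeal 𝔓 y using ENat.recTopCoe with
    | top => exact le_top
    | coe m =>
      rw [h, nsmul_eq_mul] at hNy
      have h' : ℓ * (j + 1) ≤ ℓ * m := by exact_mod_cast hNy
      exact_mod_cast Nat.le_of_mul_le_mul_left h' hℓpos
  · ------------------------------------------------------------------
    -- `j > t`: `Tr(y) ∈ 𝔓^{ℓ(j+1)}`, and the graded trace is injective
    ------------------------------------------------------------------
    have hB := succ_le_psi_of_jump_lt ℓ t j hℓ2 hjt'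
    rw [← hu] at hB
    obtain ⟨hC, hC'⟩ := psi_add_eq_of_jump_le ℓ t j hℓ2 hjt'.le
    rw [← hu] at hC hC'
    have hNy : ∏ γ : F.fixingSubgroup, (γ : L ≃ₐ[K] L) • y ∈ 𝔓 ^ (ℓ * (j + 1)) := by
      have h := prod_smul_mem_pow R F 𝔓 hF hy
      rw [← hℓdef] at h
      exact Ideal.pow_le_pow_right (Nat.mul_le_mul_left ℓ hB) h
    have hTw' : ∑ γ : F.fixingSubgroup, (γ : L ≃ₐ[K] L) • w ∈ 𝔓 ^ (ℓ * (j + 1)) := by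
      refine Ideal.pow_le_pow_right (Nat.mul_le_mul_left ℓ ((Nat.le_div_iff_mul_le hℓpos).mpr ?_)) hTw
      rw [mul_comm]; omega
    have hTy : ∑ γ : F.fixingSubgroup, (γ : L ≃ₐ[K] L) • y ∈ 𝔓 ^ (ℓ * (j + 1)) := by
      have h := Ideal.sub_mem _ (Ideal.sub_mem _ hN hNy) hTw'
      rwa [show ∑ γ : F.fixingSubgroup, (γ : L ≃ₐ[K] L) • y + ∏ γ : F.fixingSubgroup, (γ : L ≃ₐ[K] L) • y +
        ∑ γ : F.fixingSubgroup, (γ : L ≃ₐ[K] L) • w - ∏ γ : F.fixingSubgroup, (γ : L ≃ₐ[K] L) • y -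
        ∑ γ : F.fixingSubgroup, (γ : L ≃ₐ[K] L) • w = ∑ γ : F.fixingSubgroup, (γ : L ≃ₐ[K] L) • y by ring] at h
    -- a local generator, and `y₀ ∈ 𝔓^u` whose trace has exact order `j` over `F`
    obtain ⟨x, d, hx𝔓, hd, hgen⟩ := exists_generator_mem R F 𝔓 h𝔓 hF
    have hdd := emultiplicity_aeval_derivative_generator_eq_of_jump R F 𝔓 h𝔓 hF ht ht1 hd hgen
    rw [← hℓdef] at hdd
    haveI : IsDedekindDomain (integralClosure R F) := integralClosure.isDedekindDomain R K F
    haveI : Algebra.IsIntegral (integralClosure R F) (integralClosure R L) :=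
      integralClosure_isIntegral R F
    set 𝔓F := 𝔓.under (integralClosure R F) with h𝔓Fdef
    haveI : 𝔓F.IsMaximal := Ideal.IsMaximal.under _ 𝔓
    have h𝔓F : 𝔓F ≠ ⊥ := Ideal.IsIntegral.comap_ne_bot _ h𝔓
    have hlt : 𝔓F ^ (j + 1) < 𝔓F ^ j :=
      Ideal.pow_right_strictAnti 𝔓F h𝔓F (Ideal.IsMaximal.ne_top inferInstance) (Nat.lt_succ_self j)
    obtain ⟨z₀, hz₀, hz₀'⟩ := SetLike.exists_of_lt hlt
    have hz₀j : z₀ ∈ 𝔓F ^ ((u + (ℓ - 1) * (t + 1)) / ℓ) := by rw [hC']; exact hz₀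
    have hz₀j' : z₀ ∈ 𝔓F ^ ((u + (ℓ - 1) * (t + 1)) / Fintype.card F.fixingSubgroup) := by
      rw [← hℓdef]; exact hz₀j
    obtain ⟨y₀, hy₀, hTy₀⟩ := exists_sum_smul_sub_mem_pow R F 𝔓 h𝔓 hF hx𝔓 hd hgen hdd hz₀j'
      (ℓ * (j + 1))
    have hιz₀ : algebraMap (integralClosure R F) (integralClosure R L) z₀ ∉ 𝔓 ^ (ℓ * (j + 1)) := by
      intro h
      rw [hℓdef] at h
      exact hz₀' (mem_under_pow_of_algebraMap_mem_pow R F 𝔓 h𝔓 hF h)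
    have hTy₀' : ∑ γ : F.fixingSubgroup, (γ : L ≃ₐ[K] L) • y₀ ∉ 𝔓 ^ (ℓ * (j + 1)) := fun h =>
      hιz₀ (by
        have h' := Ideal.sub_mem _ h hTy₀
        rwa [sub_sub_cancel] at h')
    -- `v(y₀) = u` exactly (a deeper `y₀` would have trace in `𝔓_F^{j+1}`)
    have htrace_deep : ∀ {y' : integralClosure R L}, y' ∈ 𝔓 ^ (u + 1) →
        ∑ γ : F.fixingSubgroup, (γ : L ≃ₐ[K] L) • y' ∈ 𝔓 ^ (ℓ * (j + 1)) := by
      intro y' hy'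
      have h := sum_smul_mem_pow_of_jump R F 𝔓 h𝔓 hF ht ht1 hy'
      rw [← hℓdef] at h
      refine Ideal.pow_le_pow_right (Nat.mul_le_mul_left ℓ ((Nat.le_div_iff_mul_le hℓpos).mpr ?_)) h
      rw [mul_comm]; exact hψ3
    have hord : ordIdeal 𝔓 y₀ = u := by
      refine le_antisymm ?_ (le_ordIdeal_iff_mem_pow.mpr hy₀)
      by_contra hlt'
      have h' : ((u + 1 : ℕ) : ℕ∞) ≤ ordIdeal 𝔓 y₀ := by
        rw [not_le] at hlt'
        exact Order.add_one_le_of_lt (by exact_mod_cast hlt')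
      exact hTy₀' (htrace_deep (le_ordIdeal_iff_mem_pow.mp h'))
    -- `y ≡ a y₀ mod 𝔓^{u+1}` with `a` inertia-fixed
    have hsup := pow_le_span_sup_pow_succ 𝔓 h𝔓 hord hy
    obtain ⟨cy, hcy, y₁, hy₁, hy_eq⟩ := Submodule.mem_sup.mp hsup
    obtain ⟨c, rfl⟩ := Ideal.mem_span_singleton'.mp hcy
    haveI : 𝔓.LiesOver (𝔓.under R) := ⟨rfl⟩
    obtain ⟨a, hafix, hca⟩ := exists_inertia_fixed_sub_mem (L ≃ₐ[K] L) (𝔓.under R) 𝔓 c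
    have hafix' : ∀ γ : F.fixingSubgroup, (γ : L ≃ₐ[K] L) • a = a := fun γ => hafix _ (hF γ.2)
    have hrest : y - a * y₀ ∈ 𝔓 ^ (u + 1) := by
      have : y - a * y₀ = (c - a) * y₀ + y₁ := by rw [← hy_eq]; ring
      rw [this]
      refine Ideal.add_mem _ ?_ hy₁
      rw [add_comm u 1, pow_add, pow_one]
      exact Ideal.mul_mem_mul hca hy₀
    have haTr : a * ∑ γ : F.fixingSubgroup, (γ : L ≃ₐ[K] L) • y₀ ∈ 𝔓 ^ (ℓ * (j + 1)) := by
      have h := Ideal.sub_mem _ hTy (htrace_deep hrest)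
      have key : ∑ γ : F.fixingSubgroup, (γ : L ≃ₐ[K] L) • y -
          ∑ γ : F.fixingSubgroup, (γ : L ≃ₐ[K] L) • (y - a * y₀) =
          a * ∑ γ : F.fixingSubgroup, (γ : L ≃ₐ[K] L) • y₀ := by
        rw [← Finset.sum_sub_distrib, ← sum_smul_mul_of_invariant R F hafix']
        refine Finset.sum_congr rfl fun γ _ => ?_
        rw [smul_sub, sub_sub_cancel]
      rwa [key] at h
    have ha𝔓 : a ∈ 𝔓 := by
      by_contra ha
      exact hTy₀' (mem_pow_of_mul_mem_pow 𝔓 h𝔓 ha haTr)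
    have : y = a * y₀ + (y - a * y₀) := by ring
    rw [this]
    refine Ideal.add_mem _ ?_ hrest
    rw [add_comm u 1, pow_add, pow_one]
    exact Ideal.mul_mem_mul ha𝔓 hy₀

/-- **Serre V §3 Prop. 5 iv), surjectivity half (`N_j` is onto for `j > t`), in approximate
form.**  For the cyclic layer of prime degree `ℓ`, totally ramified at `𝔓` with jump `t`, and
`j > t`: every `Γ`-invariant `z ∈ 𝔓 ^ (ℓ j)` (a principal unit `1 + z ∈ U_F^j`) satisfies
`N_Γ(1 + y) - 1 ≡ z (mod 𝔓 ^ (ℓ (j + 1)))` for some `y ∈ 𝔓 ^ ψ(j)`: `N(1+y) ≡ 1 + Tr(y)` and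
`Tr(𝔓^{ψ(j)})` covers `𝔓_F^j` modulo `𝔓_F^{j+1}` (`exists_sum_smul_sub_mem_pow`).  With
completeness this gives Serre's Cor. 2–3 (`N(U_L^{ψ(j)}) = U_F^j`); the Hasse–Arf argument only
uses this graded surjectivity.
Ref: Serre, *Local Fields*, Ch. V §3, Prop. 5 iv) and Cor. 2–3 (p. 85).
[cite: SerreLocalFields1979, Ch. V §3 Prop. 5] -/
theorem exists_prod_one_add_smul_sub_mem_pow [Fintype F.fixingSubgroup]
    [DecidableEq F.fixingSubgroup]
    (h𝔓 : 𝔓 ≠ ⊥) [Algebra.IsSeparable (R ⧸ 𝔓.under R) (integralClosure R L ⧸ 𝔓)]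
    (hF : F.fixingSubgroup ≤ 𝔓.inertia (L ≃ₐ[K] L))
    (hℓ : (Fintype.card F.fixingSubgroup).Prime) {t : ℕ}
    (ht : ∀ γ : F.fixingSubgroup, (γ : L ≃ₐ[K] L) ∈ 𝔓.ramificationSubgroup (L ≃ₐ[K] L) t)
    (ht1 : ∀ γ : F.fixingSubgroup, γ ≠ 1 →
      (γ : L ≃ₐ[K] L) ∉ 𝔓.ramificationSubgroup (L ≃ₐ[K] L) (t + 1))
    {j : ℕ} (hjt : t < j) {z : integralClosure R L}
    (hzfix : ∀ γ : F.fixingSubgroup, (γ : L ≃ₐ[K] L) • z = z)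
    (hz : z ∈ 𝔓 ^ (Fintype.card F.fixingSubgroup * j)) :
    ∃ y ∈ 𝔓 ^ (min j t + Fintype.card F.fixingSubgroup * (j - t)),
      ∏ γ : F.fixingSubgroup, (1 + (γ : L ≃ₐ[K] L) • y) - 1 - z ∈
        𝔓 ^ (Fintype.card F.fixingSubgroup * (j + 1)) := by
  haveI : IsDedekindDomain (integralClosure R L) := integralClosure.isDedekindDomain R K L
  haveI : IsDedekindDomain (integralClosure R F) := integralClosure.isDedekindDomain R K F
  haveI : FaithfulSMul (L ≃ₐ[K] L) (integralClosure R L) := faithfulSMul_algEquiv_integralClosure R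
  haveI hGal : IsGaloisGroup F.fixingSubgroup (integralClosure R F) (integralClosure R L) :=
    isGaloisGroup_fixingSubgroup_integralClosure R F
  haveI : Algebra.IsInvariant (integralClosure R F) (integralClosure R L) F.fixingSubgroup :=
    hGal.isInvariant
  set ℓ := Fintype.card F.fixingSubgroup with hℓdef
  clear_value ℓ
  have hℓcard : (Fintype.card F.fixingSubgroup).Prime := by rw [← hℓdef]; exact hℓ
  have hℓ2 : 2 ≤ ℓ := hℓ.two_le
  have hℓpos : 0 < ℓ := by omega
  obtain ⟨hψ1, hψ2, hψ3⟩ := psi_le_and ℓ t j hℓ2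
  set u := min j t + ℓ * (j - t) with hu
  have hB := succ_le_psi_of_jump_lt ℓ t j hℓ2 hjt
  rw [← hu] at hB
  obtain ⟨hC, hC'⟩ := psi_add_eq_of_jump_le ℓ t j hℓ2 hjt.le
  rw [← hu] at hC hC'
  -- `z = ι z₀` with `z₀ ∈ 𝔓_F^j`
  obtain ⟨z₀, rfl⟩ := Algebra.IsInvariant.isInvariant (A := integralClosure R F)
    (G := F.fixingSubgroup) z fun γ => hzfix γ
  have hz₀ : z₀ ∈ 𝔓.under (integralClosure R F) ^ j := by
    rw [hℓdef] at hz
    exact mem_under_pow_of_algebraMap_mem_pow R F 𝔓 h𝔓 hF hz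
  obtain ⟨x, d, hx𝔓, hd, hgen⟩ := exists_generator_mem R F 𝔓 h𝔓 hF
  have hdd := emultiplicity_aeval_derivative_generator_eq_of_jump R F 𝔓 h𝔓 hF ht ht1 hd hgen
  rw [← hℓdef] at hdd
  have hz₀j' : z₀ ∈ 𝔓.under (integralClosure R F) ^
      ((u + (ℓ - 1) * (t + 1)) / Fintype.card F.fixingSubgroup) := by
    rw [← hℓdef, hC']; exact hz₀
  obtain ⟨y, hy, hTy⟩ := exists_sum_smul_sub_mem_pow R F 𝔓 h𝔓 hF hx𝔓 hd hgen hdd hz₀j'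
    (ℓ * (j + 1))
  refine ⟨y, hy, ?_⟩
  obtain ⟨w, hw, hNeq⟩ := norm_one_add_eq R F 𝔓 hℓcard hF hy
  rw [hNeq, show (1 : integralClosure R L) + ∑ γ : F.fixingSubgroup, (γ : L ≃ₐ[K] L) • y +
      ∏ γ : F.fixingSubgroup, (γ : L ≃ₐ[K] L) • y + ∑ γ : F.fixingSubgroup, (γ : L ≃ₐ[K] L) • w - 1 -
      algebraMap (integralClosure R F) (integralClosure R L) z₀ =
      (∑ γ : F.fixingSubgroup, (γ : L ≃ₐ[K] L) • y - algebraMap (integralClosure R F) (integralClosure R L) z₀) +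
      ∏ γ : F.fixingSubgroup, (γ : L ≃ₐ[K] L) • y + ∑ γ : F.fixingSubgroup, (γ : L ≃ₐ[K] L) • w by ring]
  have hTw := sum_smul_mem_pow_of_jump R F 𝔓 h𝔓 hF ht ht1 hw
  have hNy := prod_smul_mem_pow R F 𝔓 hF hy
  rw [← hℓdef] at hTw hNy
  refine Ideal.add_mem _ (Ideal.add_mem _ hTy ?_) ?_
  · exact Ideal.pow_le_pow_right (Nat.mul_le_mul_left ℓ hB) hNy
  · refine Ideal.pow_le_pow_right (Nat.mul_le_mul_left ℓ ((Nat.le_div_iff_mul_le hℓpos).mpr ?_)) hTw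
    rw [mul_comm]; omega

end Prop5

end Literature.NumberTheory.GaloisRepresentations

end
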